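import Literature.NumberTheory.IwasawaTheory.UnramifiedOutsidePFiniteOfCMTower
import Literature.NumberTheory.IwasawaTheory.GreenbergCyclicOrderP
import Literature.NumberTheory.IwasawaTheory.ClassicalMuInvariant
import Literature.NumberTheory.EllipticCurves.ZpExtensionRestrictCyclotomic
import Literature.NumberTheory.GaloisRepresentations.IntegralGaloisAction
import Literature.GroupTheory.PrimeOrderModuleCharacter
import Mathlib.NumberTheory.NumberField.CMField
import HarnessLib

/-!
# Greenberg's Lemma 5.9 (LNM 1716) follows from the Ferrero–Washington theorem (proved implication between the
# tree's named facts; no new named fact)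

Topic `NumberTheory/IwasawaTheory` (namespace `Literature.NumberTheory.IwasawaTheory.GreenbergLemma59OfFerreroWashington`
for the helpers; the main theorem sits next to the fact it discharges, in `Literature.NumberTheory.IwasawaTheory`).
THEOREM-ONLY file written by the prover seat `bsd-eis-lam-a` g20 (cell `bsd-eis`; `--supports`
stmt-BirchSwinnertonDyer-19035, crux 5 `MazurMCOnX1RankZero`, line `interlude_with_torsion`: its registered stub
`stub_publishedL59 : greenberg1999_lemma59_even_finite` becomes a consequence of the stub `stub_publishedFW`).

* **`greenberg1999_lemma59_even_finite_of_ferreroWashington`** —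
  `ferreroWashington1979_classicalMuVanishes → greenberg1999_lemma59_even_finite`: for an odd prime `p`, the
  cyclotomic `ℤ_p`-extension `κ` of `ℚ` and a discrete `Γ_ℚ`-module `Θ` of order `p` with continuous action on which
  the complex conjugations act trivially, the classes of `H¹(Gal(ℚ̄/ℚ_∞), Θ)` unramified outside `p` form a finite set
  (Greenberg: «`H¹(ℚ_Σ/ℚ_∞, Θ)` is finite», whose proof rests on «The `μ`-invariant of `Y^θ` vanishes as a consequence
  of the Ferrero–Washington theorem»).

The proof is Greenberg's (pp. 143–144), assembled by `UnramifiedOutsidePFiniteOfCMTower.finite_unramifiedOutside_of_cmTower`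
with: `N = ker(Γ_ℚ → Aut Θ) ∩ ker(Γ_ℚ → Aut μ_p)` (open, normal, abelian quotient of order prime to `p`:
`PrimeOrderModuleCharacter`, `exists_kernel_subgroup`, `exists_root_stabilizer`); an honest complex conjugation
`c ∈ Γ_ℚ` (`exists_isComplexConjugation`); the fields `ℚ̄^{N ∩ Γ_n}` are CM because they are abelian over `ℚ` and
contain `μ_p` (Mathlib's `IsCMField.of_isAbelianGalois`, transported along `Subsingleton (Algebra ℚ _)`); `p` is the
only prime of `ℚ` above `p` and is totally ramified in `ℚ_∞` (`CyclotomicTowerPrimesAboveBound`); and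
`ord_p h(ℚ̄^{N ∩ Γ_n}) = λ n + ν` for `n ≫ 0` by Ferrero–Washington for the abelian field `ℚ̄^N` and the restricted
cyclotomic tower (`ZpExtension.restrict`, `isCyclotomic_restrict`, `padicValNat_card_classGroup_eq_classNumberPExp`).

References: [GreenbergLNM1716] §5 Lemma 5.9 (pp. 142–144); [Washington1997] §7.5 (Ferrero–Washington), §13.1;
[NeukirchANT1999] Ch. IV §1.
-/

set_option autoImplicit false

noncomputable section

open scoped Classical Pointwise NumberField IntermediateField
open NumberField IsDedekindDomain Field IntermediateField

namespace Literature.NumberTheory.IwasawaTheory.GreenbergLemma59OfFerreroWashington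

open Literature.NumberTheory.EllipticCurves Literature.NumberTheory.EllipticCurves.GreenbergSelmer
  Literature.NumberTheory.EllipticCurves.GreenbergVatsal2000
  Literature.NumberTheory.GaloisRepresentations Literature.NumberTheory.NumberFields
  Literature.NumberTheory.IwasawaTheory.UnramifiedOutsidePFiniteOfCMTower
  Literature.NumberTheory.IwasawaTheory.CyclotomicTowerPrimesAboveBound
  Literature.NumberTheory.IwasawaTheory.EquivariantUnramifiedHomsZpTowerFinite
  Literature.GroupTheory.PrimeOrderModuleCharacter

/-! ## §1 The kernel of the action on `Θ` and the stabiliser of `ζ_p` -/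

/-- **The kernel of a continuous action on a discrete group of prime order `p`** is an open normal subgroup with
abelian quotient of order prime to `p` (Greenberg's `Gal(ℚ_Σ/ℚ(θ))`). [cite: GreenbergLNM1716, §5 Lemma 5.9 (proof, p. 143)] -/
theorem exists_kernel_subgroup (G : Type*) [Group G] [TopologicalSpace G] {Θ : Type} [AddCommGroup Θ]
    [DistribMulAction G Θ] [TopologicalSpace Θ] [DiscreteTopology Θ] {p : ℕ} [Fact p.Prime]
    (hΘ : Nat.card Θ = p) (hcont : ∀ m : Θ, Continuous fun g : G => g • m) :
    ∃ NΘ : Subgroup G, NΘ.Normal ∧ IsOpen (NΘ : Set G) ∧ (∀ σ, σ ∈ NΘ ↔ ∀ m : Θ, σ • m = m) ∧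
      ⁅(⊤ : Subgroup G), ⊤⁆ ≤ NΘ ∧ NΘ.index.Coprime p := by
  have hpr : p.Prime := Fact.out
  haveI : Finite Θ := Nat.finite_of_card_ne_zero (by rw [hΘ]; exact hpr.ne_zero)
  have hmem : ∀ σ : G, σ ∈ (MulAction.toPermHom G Θ).ker ↔ ∀ m : Θ, σ • m = m := by
    intro σ
    rw [MonoidHom.mem_ker, Equiv.ext_iff]
    exact forall_congr' fun m => Iff.rfl
  refine ⟨(MulAction.toPermHom G Θ).ker, inferInstance, ?_, hmem, commutator_le_of_mem_iff hΘ _ hmem,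
    index_coprime_of_mem_iff hΘ _ hmem⟩
  have hset : ((MulAction.toPermHom G Θ).ker : Set G) = ⋂ m : Θ, (fun g : G => g • m) ⁻¹' {m} := by
    ext σ
    simp only [SetLike.mem_coe, hmem, Set.mem_iInter, Set.mem_preimage, Set.mem_singleton_iff]
  rw [hset]
  exact isOpen_iInter_of_finite fun m => (isOpen_discrete _).preimage (hcont m)

/-- **The stabiliser in `Γ_K` of a primitive `p`-th root of unity `ζ ∈ K̄`** is an open normal subgroup with abelian
quotient of order dividing `p − 1` (the kernel of the mod-`p` cyclotomic character; Greenberg's `Gal(ℚ_Σ/ℚ(μ_p))`).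
[cite: GreenbergLNM1716, §5 Lemma 5.9 (proof, p. 143)] -/
theorem exists_root_stabilizer (K : Type) [Field K] [CharZero K] {p : ℕ} [Fact p.Prime]
    {ζ : AlgebraicClosure K} (hζ : IsPrimitiveRoot ζ p) :
    ∃ Nζ : Subgroup (absoluteGaloisGroup K), Nζ.Normal ∧ IsOpen (Nζ : Set (absoluteGaloisGroup K)) ∧
      (∀ σ, σ ∈ Nζ ↔ σ • ζ = ζ) ∧ ⁅(⊤ : Subgroup (absoluteGaloisGroup K)), ⊤⁆ ≤ Nζ ∧ Nζ.index.Coprime p := by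
  have hpr : p.Prime := Fact.out
  haveI : NeZero p := ⟨hpr.ne_zero⟩
  let χ : absoluteGaloisGroup K →* (ZMod p)ˣ :=
    (hζ.autToPow K).comp (absoluteGaloisGroup.toAlgEquiv K).toMonoidHom
  have hχ : ∀ σ : absoluteGaloisGroup K, ζ ^ ((χ σ : ZMod p).val) = σ • ζ := fun σ => hζ.autToPow_spec K _
  have hmem : ∀ σ, σ ∈ χ.ker ↔ σ • ζ = ζ := by
    intro σ
    rw [MonoidHom.mem_ker]
    constructor
    · intro h
      rw [← hχ σ, h, Units.val_one, ZMod.val_one, pow_one]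
    · intro h
      have h1 : ζ ^ (χ σ : ZMod p).val = ζ ^ (1 : ZMod p).val := by rw [hχ σ, h, ZMod.val_one, pow_one]
      have h2 : (χ σ : ZMod p).val = (1 : ZMod p).val :=
        hζ.pow_inj (ZMod.val_lt _) (by rw [ZMod.val_one]; exact hpr.one_lt) h1
      exact Units.ext (ZMod.val_injective p h2)
  refine ⟨χ.ker, inferInstance, ?_, hmem, ?_, ?_⟩
  · -- open: `χ.ker ⊇ Gal(K̄/K(ζ))`
    have hint : IsIntegral K ζ := (Algebra.IsAlgebraic.isAlgebraic ζ).isIntegral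
    haveI := IntermediateField.adjoin.finiteDimensional hint
    have h1 : IsOpen ((absoluteGaloisGroup.toAlgEquiv K) ⁻¹'
        ((K⟮ζ⟯.fixingSubgroup : Subgroup (AlgebraicClosure K ≃ₐ[K] AlgebraicClosure K)) :
          Set (AlgebraicClosure K ≃ₐ[K] AlgebraicClosure K))) :=
      K⟮ζ⟯.fixingSubgroup_isOpen.preimage continuous_id
    refine Subgroup.isOpen_mono
      (H₁ := (K⟮ζ⟯.fixingSubgroup).comap (absoluteGaloisGroup.toAlgEquiv K).toMonoidHom) ?_ h1
    intro τ hτ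
    rw [hmem]
    exact (IntermediateField.mem_fixingSubgroup_iff _ _).mp (Subgroup.mem_comap.mp hτ) ζ
      (IntermediateField.mem_adjoin_simple_self K ζ)
  · rw [← commutator_def]
    exact Abelianization.commutator_subset_ker χ
  · have h1 : χ.ker.index ∣ p - 1 := by
      rw [Subgroup.index_ker, ← ZMod.card_units p, ← Nat.card_eq_fintype_card]
      exact Subgroup.card_subgroup_dvd_card χ.range
    have h2 : (p - 1).Coprime p :=
      ((Nat.Prime.coprime_iff_not_dvd hpr).mpr
        (Nat.not_dvd_of_pos_of_lt (Nat.sub_pos_of_lt hpr.one_lt) (Nat.sub_lt hpr.pos one_pos))).symm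
    exact Nat.Coprime.coprime_dvd_left h1 h2

/-! ## §2 Transport along `Subsingleton (Algebra ℚ _)` -/

/-- A Galois number field with commutative Galois group containing a root of unity of order `> 2` is CM (Mathlib's
`IsCMField.of_isAbelianGalois`, stated for an arbitrary `ℚ`-algebra structure). [cite: Washington1997, §4 (p. 38, CM fields)] -/
theorem isCMField_of_forall_commute (L : Type) [Field L] [NumberField L] [alg : Algebra ℚ L] [IsGalois ℚ L]
    (hcomm : ∀ σ τ : L ≃ₐ[ℚ] L, σ * τ = τ * σ) (hL : IsTotallyComplex L) : IsCMField L := by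
  have h : alg = DivisionRing.toRatAlgebra := Subsingleton.elim _ _
  subst h
  haveI : IsMulCommutative (L ≃ₐ[ℚ] L) := ⟨⟨hcomm⟩⟩
  haveI : IsAbelianGalois ℚ L := {}
  haveI := hL
  exact IsCMField.of_isAbelianGalois L

/-- **Ferrero–Washington for a Galois number field with commutative Galois group**, stated for an arbitrary
`ℚ`-algebra structure (transport of the named fact along `Subsingleton (Algebra ℚ _)`). [cite: Washington1997, §7.5 Thm. 7.15] -/
theorem classicalMuVanishes_of_FW (hFW : ferreroWashington1979_classicalMuVanishes) (L : Type) [Field L]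
    [NumberField L] [alg : Algebra ℚ L] [IsGalois ℚ L] (hcomm : ∀ σ τ : L ≃ₐ[ℚ] L, σ * τ = τ * σ)
    {p : ℕ} [Fact p.Prime] (κ : ZpExtension L p) (hκ : κ.IsCyclotomic) : ClassicalMuVanishes κ := by
  have h : alg = DivisionRing.toRatAlgebra := Subsingleton.elim _ _
  subst h
  haveI : IsMulCommutative (L ≃ₐ[ℚ] L) := ⟨⟨hcomm⟩⟩
  haveI : IsAbelianGalois ℚ L := {}
  exact hFW L p κ hκ

/-! ## §3 Class-number growth along `K̄^{N ∩ Γ_n}` from `μ = 0` for `K̄^N` -/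

/-- If `N ≤ Γ_K` is open of index prime to `p` and the restricted `ℤ_p`-extension of `K₀ = K̄^N` has classical `μ = 0`
(growth form), then `ord_p h(K̄^{N ∩ κ⁻¹(pⁿℤ_p)}) ≤ λ n + ν` for `n ≫ 0` (`K̄^{N ∩ Γ_n} = K₀ K_n` is the `n`-th layer
of the restricted tower). [cite: Washington1997, §13.1 and §13.3] -/
theorem exists_growth_of_classicalMuVanishes {K : Type} [Field K] [NumberField K] {p : ℕ} [Fact p.Prime]
    (κ : ZpExtension K p) (N : Subgroup (absoluteGaloisGroup K)) (hN : IsOpen (N : Set (absoluteGaloisGroup K)))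
    [NumberField (fixedField N : IntermediateField K (AlgebraicClosure K))] (hndvd : ¬ p ∣ N.index)
    (hμ : ∀ h : Function.Surjective (κ.toContinuousMonoidHom.comp
      (absGaloisRestrict K (fixedField N : IntermediateField K (AlgebraicClosure K)))),
      ClassicalMuVanishes (κ.restrict (fixedField N : IntermediateField K (AlgebraicClosure K)) h)) :
    ∃ l ν n₀ : ℕ, ∀ n, n₀ ≤ n → padicValNat p (Nat.card (ClassGroup
      (𝓞 (fixedField (N ⊓ κ.layerSubgroup n) : IntermediateField K (AlgebraicClosure K))))) ≤ l * n + ν := by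
  have h : Function.Surjective (κ.toContinuousMonoidHom.comp
      (absGaloisRestrict K (fixedField N : IntermediateField K (AlgebraicClosure K)))) :=
    κ.surjective_comp_absGaloisRestrict_of_not_dvd_finrank _ (by rwa [finrank_fixedField_of_isOpen N hN])
  obtain ⟨l, ν, n₀, hgr⟩ := hμ h
  refine ⟨l, ν.toNat, n₀, fun n hn => ?_⟩
  haveI : NumberField (↥((fixedField N : IntermediateField K (AlgebraicClosure K)) ⊔ κ.layer n)) := by
    rw [← fixedField_inf_layerSubgroup κ N hN n]
    exact numberField_fixedField_of_isOpen _ (hN.inter (κ.isOpen_layerSubgroup n))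
  rw [fixedField_inf_layerSubgroup κ N hN n, padicValNat_card_classGroup_eq_classNumberPExp κ N h n]
  have h1 := hgr n hn
  have h2 : ((classNumberPExp (κ.restrict (fixedField N : IntermediateField K (AlgebraicClosure K)) h) n : ℕ) : ℤ)
      ≤ (l * n + ν.toNat : ℕ) := by
    rw [h1]; push_cast; gcongr; exact Int.self_le_toNat ν
  exact_mod_cast h2

end Literature.NumberTheory.IwasawaTheory.GreenbergLemma59OfFerreroWashington

/-! ## §4 Greenberg's Lemma 5.9 from Ferrero–Washington -/

namespace Literature.NumberTheory.IwasawaTheory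

open Literature.NumberTheory.EllipticCurves Literature.NumberTheory.EllipticCurves.GreenbergSelmer
  Literature.NumberTheory.EllipticCurves.GreenbergVatsal2000
  Literature.NumberTheory.GaloisRepresentations Literature.NumberTheory.NumberFields
  Literature.NumberTheory.IwasawaTheory.UnramifiedOutsidePFiniteOfCMTower
  Literature.NumberTheory.IwasawaTheory.CyclotomicTowerPrimesAboveBound
  Literature.NumberTheory.IwasawaTheory.EquivariantUnramifiedHomsZpTowerFinite
  Literature.NumberTheory.IwasawaTheory.GreenbergLemma59OfFerreroWashington

/-- **Greenberg's Lemma 5.9 follows from the Ferrero–Washington theorem**: for `p` odd, `κ` the cyclotomic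
`ℤ_p`-extension of `ℚ` and `Θ` a discrete `Γ_ℚ`-module of order `p` with continuous action on which every complex
conjugation acts trivially, the classes of `H¹(Gal(ℚ̄/ℚ_∞), Θ)` unramified at all places not above `p` form a finite
set.  See the module docstring for the proof. [cite: GreenbergLNM1716, §5 Lemma 5.9 (pp. 142–144)]
[cite: Washington1997, §7.5 Thm. 7.15 and §13.1] -/
theorem greenberg1999_lemma59_even_finite_of_ferreroWashington (hFW : ferreroWashington1979_classicalMuVanishes) :
    greenberg1999_lemma59_even_finite := by
  intro p _ hp2 κQ hκQ Θ _ _ _ _ hΘ hcont heven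
  classical
  have hpr : p.Prime := Fact.out
  have hp2' : 2 < p := lt_of_le_of_ne hpr.two_le (Ne.symm hp2)
  -- the kernel of `Θ` and the stabiliser of `ζ_p`
  obtain ⟨NΘ, hNΘn, hNΘo, hNΘmem, hNΘcomm, hNΘcop⟩ := exists_kernel_subgroup (absoluteGaloisGroup ℚ) hΘ hcont
  haveI : NeZero ((p : ℕ) : ℚ) := ⟨Nat.cast_ne_zero.mpr hpr.ne_zero⟩
  obtain ⟨ζ, hζ⟩ := HasEnoughRootsOfUnity.exists_primitiveRoot (AlgebraicClosure ℚ) p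
  obtain ⟨Nζ, hNζn, hNζo, hNζmem, hNζcomm, hNζcop⟩ := exists_root_stabilizer ℚ hζ
  haveI := hNΘn
  haveI := hNζn
  obtain ⟨N, hN⟩ : ∃ N : Subgroup (absoluteGaloisGroup ℚ), N = NΘ ⊓ Nζ := ⟨_, rfl⟩
  haveI hNn : N.Normal := by rw [hN]; infer_instance
  have hNopen : IsOpen (N : Set (absoluteGaloisGroup ℚ)) := by rw [hN]; exact hNΘo.inter hNζo
  have hNΘ : ∀ σ ∈ N, ∀ m : Θ, σ • m = m := fun σ hσ =>
    (hNΘmem σ).mp (by rw [hN] at hσ; exact (Subgroup.mem_inf.mp hσ).1)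
  have hζN : ∀ σ ∈ N, σ • ζ = ζ := fun σ hσ =>
    (hNζmem σ).mp (by rw [hN] at hσ; exact (Subgroup.mem_inf.mp hσ).2)
  have hNcomm : ⁅(⊤ : Subgroup (absoluteGaloisGroup ℚ)), ⊤⁆ ≤ N := by
    rw [hN]; exact le_inf hNΘcomm hNζcomm
  have hNcop : N.index.Coprime p := by
    rw [hN]
    have h1 : (NΘ ⊓ Nζ).index ∣ NΘ.index * Nζ.index := by
      rw [← Subgroup.relIndex_mul_index (inf_le_right : NΘ ⊓ Nζ ≤ Nζ), Subgroup.inf_relIndex_right]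
      exact mul_dvd_mul_right (Subgroup.relIndex_dvd_index_of_normal _ _) _
    exact Nat.Coprime.coprime_dvd_left h1 (Nat.Coprime.mul_left hNΘcop hNζcop)
  have hndvd : ¬ p ∣ N.index := (Nat.Prime.coprime_iff_not_dvd hpr).mp hNcop.symm
  -- an honest complex conjugation
  obtain ⟨c, hc⟩ := exists_isComplexConjugation (Rat.castHom ℝ)
  have hcΘ : ∀ m : Θ, c • m = m := heven c hc
  obtain ⟨ι, -, hι⟩ := isComplexConjugation_iff.mp hc
  -- the place `p` of `ℚ` and a prime of `\bar ℤ` above it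
  obtain ⟨v, hv⟩ : ∃ v : HeightOneSpectrum (𝓞 ℚ), ((p : ℕ) : 𝓞 ℚ) ∈ v.asIdeal := by
    refine ⟨Rat.HeightOneSpectrum.primesEquiv.symm ⟨p, hpr⟩, ?_⟩
    have h1 : Rat.HeightOneSpectrum.natGenerator
        ((Rat.HeightOneSpectrum.primesEquiv (R := 𝓞 ℚ)).symm ⟨p, hpr⟩) = p :=
      congrArg Subtype.val (Equiv.apply_symm_apply (Rat.HeightOneSpectrum.primesEquiv (R := 𝓞 ℚ)) ⟨p, hpr⟩)
    have h2 := (Rat.HeightOneSpectrum.natGenerator_dvd_iff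
      ((Rat.HeightOneSpectrum.primesEquiv (R := 𝓞 ℚ)).symm ⟨p, hpr⟩)).mp (Dvd.intro 1 (by rw [mul_one, h1]))
    rwa [← map_natCast (Rat.IsIntegralClosure.intEquiv (𝓞 ℚ)) p, Ideal.apply_mem_of_equiv_iff] at h2
  obtain ⟨𝔓, h𝔓⟩ := HeightOneSpectrum.primesAbove_nonempty v
  have huniq : ∀ w : HeightOneSpectrum (𝓞 ℚ), ((p : ℕ) : 𝓞 ℚ) ∈ w.asIdeal → w = v :=
    fun w hw => eq_of_natCast_mem hw hv
  have htot := inertia_sup_kerSubgroup_eq_top_of_natCast_mem hκQ hv h𝔓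
  -- commutators lie in the layer subgroups
  have hck : ⁅(⊤ : Subgroup (absoluteGaloisGroup ℚ)), ⊤⁆ ≤ κQ.kerSubgroup := by
    rw [← commutator_def]
    exact Abelianization.commutator_subset_ker κQ.toContinuousMonoidHom.toMonoidHom
  -- class-number growth from Ferrero–Washington for the abelian field `ℚ̄^N`
  haveI hK₀ := numberField_fixedField_of_isOpen N hNopen
  obtain ⟨l, ν, n₀, hgrowth⟩ := exists_growth_of_classicalMuVanishes κQ N hNopen hndvd fun h =>
    @classicalMuVanishes_of_FW hFW _ _ hK₀ (_) (isGalois_fixedField_of_isOpen N hNopen)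
      (commute_of_commutator_le N hNopen hNcomm) p _ _ (κQ.isCyclotomic_restrict hκQ _ h)
  -- assemble; the remaining goal: the fields `ℚ̄^{N ∩ Γ_n}` are CM
  refine finite_unramifiedOutside_of_cmTower hp2 κQ hΘ hcont N hNopen hNΘ hNcomm hNcop
    (fun n => N ⊓ κQ.layerSubgroup n) (fun n => rfl) hζ hζN ι c hι hcΘ ?_ huniq h𝔓 htot hgrowth
  intro n
  have ho : IsOpen ((N ⊓ κQ.layerSubgroup n : Subgroup (absoluteGaloisGroup ℚ)) :
      Set (absoluteGaloisGroup ℚ)) := hNopen.inter (κQ.isOpen_layerSubgroup n)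
  have hcommn : ⁅(⊤ : Subgroup (absoluteGaloisGroup ℚ)), ⊤⁆ ≤ N ⊓ κQ.layerSubgroup n :=
    le_inf hNcomm (hck.trans (κQ.kerSubgroup_le_layerSubgroup n))
  have hNF := numberField_fixedField_of_isOpen (N ⊓ κQ.layerSubgroup n) ho
  have hζn : ζ ∈ fixedField (N ⊓ κQ.layerSubgroup n) :=
    (mem_fixedField_iff _ _).mpr fun σ hσ => hζN σ (Subgroup.mem_inf.mp hσ).1
  have hζ' : IsPrimitiveRoot (⟨ζ, hζn⟩ : ↥(fixedField (N ⊓ κQ.layerSubgroup n))) p :=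
    IsPrimitiveRoot.coe_submonoidClass_iff.mp hζ
  have hTC := @isTotallyComplex_of_isPrimitiveRoot _ _ hNF _ _ hζ' hp2'
  exact @isCMField_of_forall_commute _ _ hNF (_) (isGalois_fixedField_of_isOpen _ ho)
    (commute_of_commutator_le _ ho hcommn) hTC

end Literature.NumberTheory.IwasawaTheory

end
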